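import Mathlib

/-!
# Boost weights: extreme coefficients of non-negative / constant exponential sums
# (negative-side support file for crux `PencilRigidity.NPointIsotropy`, stmt-QuantumFields-11686)

The finite-dimensional positivity engine shared by
* the standing disprover's Borchers-class no-go (`Cruxes/NPointIsotropy/Disproof.lean` §11, step (3)): along a boost
  one-parameter group a sector function decomposes into finitely many real weights, `g ∘ Λ_η = Σ_w e^{wη} g_w`; the top
  weight component of a pointwise non-negative `g ∘ Λ_η` is non-negative, and a sum of such exponential polynomials that
  is CONSTANT in `η` has vanishing extreme coefficients, whence every summand is boost invariant;
* the picked line's bet `stub_harmonicKill` (`Lines/complex-rotation-bandlimit.lean`): a band-limited orbit function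
  `Ξ_F(θ) = Σ_{|k| ≤ K} c_k e^{4ikθ}` continued to the imaginary axis is the real exponential sum `Σ c_k e^{-4kχ}`, and
  reflection positivity there (`Ξ_{ΘG ∪ G}(iχ) = ‖boosted vector‖² ≥ 0`) controls exactly its extreme coefficients.

Contents (elementary, sorry-free), for the real exponential sum `E_c(χ) = Σ_{k ∈ [-K, K]} c_k e^{kχ}` written out as
`∑ k ∈ Finset.Icc (-K) K, c k * Real.exp (k * χ)`: `E_c(χ) e^{-Kχ} → c_K` (`tendsto_expSum_mul_exp_neg`);
`E_c ≥ 0 ⇒ c_K ≥ 0 ∧ c_{-K} ≥ 0` (`coeff_top_nonneg`, `coeff_bot_nonneg`); `E_c ≡ d ⇒ c_k = 0` for every `k ≠ 0`, and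
`d = c_0` (`coeff_eq_zero_of_expSum_const`, `const_eq_coeff_zero`); the family version of §11(3): if every
`E_{c_i} ≥ 0` and `Σ_i E_{c_i}` is constant then all extreme coefficients vanish
(`coeff_top_eq_zero_of_nonneg_of_sum_const`).
-/

noncomputable section

namespace Summit.QuantumFields.YangMills.Theorems.NPointIsotropy.Negative.BoostWeights

open Filter Topology Finset

/-- Reflecting `χ ↦ -χ` reflects the coefficients. -/
theorem expSum_neg (c : ℤ → ℝ) (K : ℕ) (χ : ℝ) :
    (∑ k ∈ Icc (-(K : ℤ)) K, c k * Real.exp (k * -χ)) =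
      ∑ k ∈ Icc (-(K : ℤ)) K, c (-k) * Real.exp (k * χ) := by
  have hmap : (Icc (-(K : ℤ)) K).map (Equiv.neg ℤ).toEmbedding = Icc (-(K : ℤ)) K := by
    ext k
    simp only [Finset.mem_map, Equiv.toEmbedding_apply, Equiv.neg_apply, mem_Icc]
    constructor
    · rintro ⟨j, ⟨hj1, hj2⟩, rfl⟩
      omega
    · rintro ⟨hk1, hk2⟩
      exact ⟨-k, by omega, by ring⟩
  conv_rhs => rw [← hmap]
  rw [Finset.sum_map]
  refine Finset.sum_congr rfl fun k _ => ?_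
  simp only [Equiv.toEmbedding_apply, Equiv.neg_apply, neg_neg, Int.cast_neg, neg_mul, mul_neg]

/-- `E_c(χ) e^{-Kχ} → c_K` as `χ → +∞`. -/
theorem tendsto_expSum_mul_exp_neg (c : ℤ → ℝ) (K : ℕ) :
    Tendsto (fun χ => (∑ k ∈ Icc (-(K : ℤ)) K, c k * Real.exp (k * χ)) * Real.exp (-(K * χ))) atTop
      (𝓝 (c K)) := by
  have hlim : ∀ k ∈ Icc (-(K : ℤ)) K,
      Tendsto (fun χ : ℝ => c k * Real.exp (k * χ) * Real.exp (-(K * χ))) atTop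
        (𝓝 (if k = K then c K else 0)) := by
    intro k hk
    rw [mem_Icc] at hk
    by_cases hkK : k = K
    · subst hkK
      simp only [if_true]
      have : (fun χ : ℝ => c (K : ℤ) * Real.exp ((K : ℤ) * χ) * Real.exp (-(K * χ))) = fun _ => c K := by
        funext χ
        rw [mul_assoc, ← Real.exp_add]
        simp
      rw [this]
      exact tendsto_const_nhds
    · simp only [hkK, if_false]
      have hlt : (k : ℝ) < K := by
        have : k < (K : ℤ) := lt_of_le_of_ne hk.2 hkK
        exact_mod_cast this
      have hpos : 0 < (K : ℝ) - k := sub_pos.2 hlt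
      have h1 : Tendsto (fun χ : ℝ => ((K : ℝ) - k) * χ) atTop atTop :=
        tendsto_id.const_mul_atTop hpos
      have h2 : Tendsto (fun χ : ℝ => Real.exp (-(((K : ℝ) - k) * χ))) atTop (𝓝 0) :=
        Real.tendsto_exp_neg_atTop_nhds_zero.comp h1
      have h3 : Tendsto (fun χ : ℝ => c k * Real.exp (-(((K : ℝ) - k) * χ))) atTop (𝓝 (c k * 0)) :=
        h2.const_mul (c k)
      rw [mul_zero] at h3
      refine h3.congr' (Eventually.of_forall fun χ => ?_)
      simp only
      rw [mul_assoc, ← Real.exp_add]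
      congr 2
      ring
  have hsum := tendsto_finsetSum (Icc (-(K : ℤ)) K) hlim
  have hval : (∑ k ∈ Icc (-(K : ℤ)) K, (if k = (K : ℤ) then c K else 0)) = c K := by
    rw [Finset.sum_ite_eq']
    simp
  rw [hval] at hsum
  refine hsum.congr' (Eventually.of_forall fun χ => ?_)
  simp only [Finset.sum_mul]

/-- A non-negative exponential sum has non-negative TOP coefficient. -/
theorem coeff_top_nonneg {c : ℤ → ℝ} {K : ℕ}
    (h : ∀ χ : ℝ, 0 ≤ ∑ k ∈ Icc (-(K : ℤ)) K, c k * Real.exp (k * χ)) : 0 ≤ c K :=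
  ge_of_tendsto' (tendsto_expSum_mul_exp_neg c K) fun χ =>
    mul_nonneg (h χ) (Real.exp_pos _).le

/-- A non-negative exponential sum has non-negative BOTTOM coefficient. -/
theorem coeff_bot_nonneg {c : ℤ → ℝ} {K : ℕ}
    (h : ∀ χ : ℝ, 0 ≤ ∑ k ∈ Icc (-(K : ℤ)) K, c k * Real.exp (k * χ)) : 0 ≤ c (-K) := by
  have h' : ∀ χ : ℝ, 0 ≤ ∑ k ∈ Icc (-(K : ℤ)) K, (fun j => c (-j)) k * Real.exp (k * χ) := fun χ => by
    have := h (-χ)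
    rw [expSum_neg] at this
    exact this
  exact coeff_top_nonneg h'

/-- A CONSTANT exponential sum with `K ≥ 1` has vanishing top coefficient. -/
theorem coeff_top_eq_zero_of_const {c : ℤ → ℝ} {K : ℕ} {d : ℝ} (hK : 1 ≤ K)
    (h : ∀ χ : ℝ, (∑ k ∈ Icc (-(K : ℤ)) K, c k * Real.exp (k * χ)) = d) : c K = 0 := by
  have h1 := tendsto_expSum_mul_exp_neg c K
  have h2 : Tendsto (fun χ => (∑ k ∈ Icc (-(K : ℤ)) K, c k * Real.exp (k * χ)) * Real.exp (-(K * χ)))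
      atTop (𝓝 0) := by
    have hpos : 0 < (K : ℝ) := by exact_mod_cast hK
    have ha : Tendsto (fun χ : ℝ => (K : ℝ) * χ) atTop atTop := tendsto_id.const_mul_atTop hpos
    have hb : Tendsto (fun χ : ℝ => Real.exp (-((K : ℝ) * χ))) atTop (𝓝 0) :=
      Real.tendsto_exp_neg_atTop_nhds_zero.comp ha
    have hc : Tendsto (fun χ : ℝ => d * Real.exp (-((K : ℝ) * χ))) atTop (𝓝 (d * 0)) := hb.const_mul d
    rw [mul_zero] at hc
    refine hc.congr' (Eventually.of_forall fun χ => ?_)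
    simp only [h χ]
  exact tendsto_nhds_unique h1 h2

/-- A CONSTANT exponential sum with `K ≥ 1` has vanishing bottom coefficient. -/
theorem coeff_bot_eq_zero_of_const {c : ℤ → ℝ} {K : ℕ} {d : ℝ} (hK : 1 ≤ K)
    (h : ∀ χ : ℝ, (∑ k ∈ Icc (-(K : ℤ)) K, c k * Real.exp (k * χ)) = d) : c (-K) = 0 := by
  have h' : ∀ χ : ℝ, (∑ k ∈ Icc (-(K : ℤ)) K, (fun j => c (-j)) k * Real.exp (k * χ)) = d := fun χ => by
    have := h (-χ)
    rw [expSum_neg] at this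
    exact this
  exact coeff_top_eq_zero_of_const (c := fun j => c (-j)) hK h'

/-- Dropping vanishing extreme coefficients lowers `K` by one. -/
theorem expSum_succ_of_extremes_zero {c : ℤ → ℝ} {K : ℕ} (htop : c (K + 1 : ℕ) = 0)
    (hbot : c (-(K + 1 : ℕ)) = 0) (χ : ℝ) :
    (∑ k ∈ Icc (-((K + 1 : ℕ) : ℤ)) ((K + 1 : ℕ) : ℤ), c k * Real.exp (k * χ)) =
      ∑ k ∈ Icc (-(K : ℤ)) K, c k * Real.exp (k * χ) := by
  have hsplit : Icc (-((K + 1 : ℕ) : ℤ)) ((K + 1 : ℕ) : ℤ) =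
      insert (-((K + 1 : ℕ) : ℤ)) (insert ((K + 1 : ℕ) : ℤ) (Icc (-(K : ℤ)) K)) := by
    ext k
    simp only [mem_Icc, Finset.mem_insert]
    push_cast
    omega
  rw [hsplit, Finset.sum_insert, Finset.sum_insert]
  · rw [htop, hbot]
    ring
  · simp only [mem_Icc]
    push_cast
    omega
  · simp only [Finset.mem_insert, mem_Icc]
    push_cast
    omega

/-- **A constant real exponential sum has no non-zero weight**: if `Σ_{|k| ≤ K} c_k e^{kχ} = d` for all real `χ`
then `c_k = 0` for every `k ≠ 0` with `|k| ≤ K`. -/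
theorem coeff_eq_zero_of_expSum_const :
    ∀ (K : ℕ) (c : ℤ → ℝ) (d : ℝ), (∀ χ : ℝ, (∑ k ∈ Icc (-(K : ℤ)) K, c k * Real.exp (k * χ)) = d) →
      ∀ k : ℤ, k ∈ Icc (-(K : ℤ)) K → k ≠ 0 → c k = 0 := by
  intro K
  induction K with
  | zero =>
    intro c d _ k hk hk0
    rw [mem_Icc] at hk
    push_cast at hk
    omega
  | succ K ih =>
    intro c d h k hk hk0
    have hK : 1 ≤ K + 1 := Nat.le_add_left 1 K
    have htop : c ((K + 1 : ℕ) : ℤ) = 0 := coeff_top_eq_zero_of_const hK h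
    have hbot : c (-((K + 1 : ℕ) : ℤ)) = 0 := coeff_bot_eq_zero_of_const hK h
    by_cases hkt : k = ((K + 1 : ℕ) : ℤ)
    · rw [hkt]; exact htop
    by_cases hkb : k = -((K + 1 : ℕ) : ℤ)
    · rw [hkb]; exact hbot
    have h' : ∀ χ : ℝ, (∑ k ∈ Icc (-(K : ℤ)) K, c k * Real.exp (k * χ)) = d := fun χ => by
      rw [← expSum_succ_of_extremes_zero htop hbot χ]
      exact h χ
    refine ih c d h' k ?_ hk0
    rw [mem_Icc] at hk ⊢
    push_cast at hk hkt hkb ⊢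
    omega

/-- … and the constant is the weight-zero coefficient. -/
theorem const_eq_coeff_zero {K : ℕ} {c : ℤ → ℝ} {d : ℝ}
    (h : ∀ χ : ℝ, (∑ k ∈ Icc (-(K : ℤ)) K, c k * Real.exp (k * χ)) = d) : d = c 0 := by
  have hz := coeff_eq_zero_of_expSum_const K c d h
  rw [← h 0, Finset.sum_eq_single (0 : ℤ)]
  · simp
  · intro k hk hk0
    rw [hz k hk hk0, zero_mul]
  · intro h0'
    exfalso
    apply h0'
    rw [mem_Icc]
    omega

/-- **The family version (Disproof §11, step (3)).** If finitely many real exponential sums are each pointwise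
non-negative and their sum is constant, then every top and every bottom coefficient vanishes (for `K ≥ 1`). -/
theorem coeff_top_eq_zero_of_nonneg_of_sum_const {ι : Type*} (s : Finset ι) (c : ι → ℤ → ℝ) {K : ℕ}
    (hK : 1 ≤ K) (hpos : ∀ i ∈ s, ∀ χ : ℝ, 0 ≤ ∑ k ∈ Icc (-(K : ℤ)) K, c i k * Real.exp (k * χ)) {d : ℝ}
    (hsum : ∀ χ : ℝ, (∑ i ∈ s, ∑ k ∈ Icc (-(K : ℤ)) K, c i k * Real.exp (k * χ)) = d) :
    ∀ i ∈ s, c i K = 0 ∧ c i (-K) = 0 := by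
  -- the sum of the family is the exponential sum of the summed coefficients
  have hS : ∀ χ : ℝ, (∑ k ∈ Icc (-(K : ℤ)) K, (fun j => ∑ i ∈ s, c i j) k * Real.exp (k * χ)) = d :=
    fun χ => by
    rw [← hsum χ, Finset.sum_comm]
    refine Finset.sum_congr rfl fun i _ => ?_
    rw [Finset.sum_mul]
  have htop : (∑ i ∈ s, c i K) = 0 := coeff_top_eq_zero_of_const (c := fun j => ∑ i ∈ s, c i j) hK hS
  have hbot : (∑ i ∈ s, c i (-K)) = 0 := coeff_bot_eq_zero_of_const (c := fun j => ∑ i ∈ s, c i j) hK hS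
  have htop' : ∀ i ∈ s, c i K = 0 :=
    (Finset.sum_eq_zero_iff_of_nonneg fun i hi => coeff_top_nonneg (hpos i hi)).1 htop
  have hbot' : ∀ i ∈ s, c i (-K) = 0 :=
    (Finset.sum_eq_zero_iff_of_nonneg fun i hi => coeff_bot_nonneg (hpos i hi)).1 hbot
  exact fun i hi => ⟨htop' i hi, hbot' i hi⟩

end Summit.QuantumFields.YangMills.Theorems.NPointIsotropy.Negative.BoostWeights

end
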